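import Summits.HodgeConjecture.CorCM.HypLiu418.A3Liu418HonestIsogenyDescent
import Literature.NumberTheory.Automorphic.Liu2021.AppendixC.EtaleBettiComparisonHolds
import HarnessLib

/-!
# [Liu2021, §4.3 l. 2154–2160] row VI-2″ at the face: `stub_etaleComparisonAtFace` of the line `a3_liu418` (v4 :569),
# CLOSED BY NAME with no residual hypothesis

THEOREMS ONLY (no definition, no named fact, no instance, no `sorry`).  Cell hodgecm-mathlib, fan A, rung A-III, seat A-p16 (g2); crux
`HLiu418` = stmt-HodgeConjecture-24832, skeleton `Cruxes/HLiu418/Lines/a3_liu418.lean` v4 de740f8ad3d43177, FACT-LEVEL residual :569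
`stub_etaleComparisonAtFace : EtaleComparisonAtFace` (:395) = the ∀-closure over the face of B-typ04's named fact
`Sec42Data.exists_etaleHeckeDatum_with_bettiComparison` (p595473, `EtaleBettiComparison.lean` :245).  HC_CM is proved only modulo the 7
printed citations until rung 0 closes.

`stubEtaleComparisonAtFace_holds : <EtaleComparisonAtFace :395 VERBATIM, the face abbreviations CV ∕ TV unfolded>` := the Literature
theorem `Sec42Data.exists_etaleHeckeDatum_with_bettiComparison_of_isogenyDescent` (`EtaleBettiComparisonHolds.lean`: the fact holds for EVERY
tower granted `T.IsogenyDescent`; étale Hecke datum `T.etaleHeckeDatumOfTranslates` induced by the translates, comparison `B.cmpAlong` over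
`h1ComparisonFamilyAlong τ' ℓ ι` = [SGA4 XI 4.4] in degree one, PROVED in `H1ComparisonFamilyHolds.lean`) at `V`'s own §4.2 datum
`ℭ_V = sec42DataOf …` and its Albanese Hecke translates `T_V = heckeTranslatesFamilyOf …`, fed with row (D) AT THE PIN — A-p12's
UNCONDITIONAL `stubHonestIsogenyDescent_holds` (`HypLiu418/A3Liu418HonestIsogenyDescent.lean`, p604826).  SLOT (v5):
`theorem stub_etaleComparisonAtFace : EtaleComparisonAtFace := stubEtaleComparisonAtFace_holds` (sorries 7 → 6; row VI-2″ debt −1).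
Strategy token: «étale twin of RestOneHecke + norm-endomorphism descent from (D) + pinning-forced injectivity» (row (I) not used).
-/

set_option autoImplicit false

noncomputable section

namespace Summit.HodgeConjecture.CorCM.Lines.A3Liu418

open scoped TensorProduct Matrix
open NumberField NumberField.InfinitePlace
open HodgeCM.Model HodgeCM.Model.LiuIndex HodgeCM.Model.TowerCarrier
open Summit.HodgeConjecture.CorCM.Model
open Literature.AlgebraicGeometry.Motives (CMType)
open Literature.AlgebraicGeometry.ShimuraVarieties.UnitaryCanonicalModel
open Literature.NumberTheory.Automorphic
open Literature.NumberTheory.Automorphic.Liu2021 Literature.NumberTheory.Automorphic.Liu2021.AppendixC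
open Summit.HodgeConjecture.CorCM.Transposition

set_option synthInstance.maxHeartbeats 400000 in
set_option maxHeartbeats 8000000 in
/-- **Row VI-2″ `EtaleComparisonAtFace` of `a3_liu418` v4 (:395) HOLDS** (statement verbatim, `CV`/`TV` unfolded): for every hDel datum at a
face (`6 ≤ [F:ℚ]`), every prime `ℓ`, embedding `τ'`, `ι' : ℂ ≃ ℚ_ℓ^{ac}` and every Betti tower `(H, rhoB)` PINNED by `B` to the Albanese
levels of `V`'s own §4.2 datum along its Hecke translates, the named fact `Sec42Data.exists_etaleHeckeDatum_with_bettiComparison` holds —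
from `exists_etaleHeckeDatum_with_bettiComparison_of_isogenyDescent` and row (D) at the pin (`stubHonestIsogenyDescent_holds`).
[cite: Liu2021, §4.3 (FJcycle.tex l. 2154–2160); §4.2 l. 2074, 2079–2081; Thm. 4.18 (1) l. 2239; Lem. 2.4 (1)] [cite: SGA4Tome3, Exp. XI Thm. 4.4] -/
theorem stubEtaleComparisonAtFace_holds :
  ∀ (hDel : Literature.AlgebraicGeometry.ShimuraVarieties.UnitaryCanonicalModel.canonicalModel_exists_printed)
      (F : HodgeCM.CMField) [IsGalois ℚ F] (h6 : 6 ≤ Module.finrank ℚ F) {ι₁ : F →+* ℂ} (V : HodgeCM.HermSpace3 F ι₁) (Φ : CMType F)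
      (ℓ : ℕ) [Fact ℓ.Prime] (τ' : (F : Type) →+* ℂ) (ι' : ℂ ≃+* AlgebraicClosure ℚ_[ℓ]) (H : Type) [AddCommGroup H] [Module ℂ H]
      (rhoB : Representation ℂ (sec42DataOf (Summit.HodgeConjecture.CorCM.DelRec.exists_recordSystem_of_printed hDel) isoOf ⟨HodgeCM.CMField.K F⟩ ι₁ ⟨HodgeCM.HermSpace3.Hm V, HodgeCM.HermSpace3.isHermitian V, HodgeCM.HermSpace3.signature_ι₁ V, HodgeCM.HermSpace3.posDef_of_ne V⟩ Φ).G H)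
      (B : (sec42DataOf (Summit.HodgeConjecture.CorCM.DelRec.exists_recordSystem_of_printed hDel) isoOf ⟨HodgeCM.CMField.K F⟩ ι₁ ⟨HodgeCM.HermSpace3.Hm V, HodgeCM.HermSpace3.isHermitian V, HodgeCM.HermSpace3.signature_ι₁ V, HodgeCM.HermSpace3.posDef_of_ne V⟩ Φ).BettiPinning
        (heckeTranslatesFamilyOf heckeTranslate_definedOver_holds (Summit.HodgeConjecture.CorCM.DelRec.exists_recordSystem_of_printed hDel) isoOf ⟨HodgeCM.CMField.K F⟩ ι₁ ⟨HodgeCM.HermSpace3.Hm V, HodgeCM.HermSpace3.isHermitian V, HodgeCM.HermSpace3.signature_ι₁ V, HodgeCM.HermSpace3.posDef_of_ne V⟩ Φ h6) τ' H rhoB),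
      (sec42DataOf (Summit.HodgeConjecture.CorCM.DelRec.exists_recordSystem_of_printed hDel) isoOf ⟨HodgeCM.CMField.K F⟩ ι₁ ⟨HodgeCM.HermSpace3.Hm V, HodgeCM.HermSpace3.isHermitian V, HodgeCM.HermSpace3.signature_ι₁ V, HodgeCM.HermSpace3.posDef_of_ne V⟩ Φ).exists_etaleHeckeDatum_with_bettiComparison
        ℓ (heckeTranslatesFamilyOf heckeTranslate_definedOver_holds (Summit.HodgeConjecture.CorCM.DelRec.exists_recordSystem_of_printed hDel) isoOf ⟨HodgeCM.CMField.K F⟩ ι₁ ⟨HodgeCM.HermSpace3.Hm V, HodgeCM.HermSpace3.isHermitian V, HodgeCM.HermSpace3.signature_ι₁ V, HodgeCM.HermSpace3.posDef_of_ne V⟩ Φ h6) τ' ι' H rhoB B := by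
  intro hDel F _ h6 ι₁ V Φ ℓ _ τ' ι' H _ _ rhoB B
  exact Sec42Data.exists_etaleHeckeDatum_with_bettiComparison_of_isogenyDescent _ ℓ
    (stubHonestIsogenyDescent_holds hDel F h6 V Φ) τ' ι' H rhoB B

end Summit.HodgeConjecture.CorCM.Lines.A3Liu418

end
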